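import Summits.Ventures.CertifiedManyBodySolver.Theses.CovHg1201M19b

/-! BC3 birth skeleton — route CovHg1201M19b («hubbard-cov-hg1201-1»), crux PatchLeftEdge (planner hubbard-obs-lead g18, 2026-08-28).
Two genuine pieces: the LOW-U station segment U' ∈ [7/2, 5] (vertex parents (7/2, 5) at t′ = −27/50 — the corner lives here; BC5 first rung = stub_leftEdge_lowU, plan-only) and the HIGH-U segment U' ∈ [5, 44/5] (vertex parents (5, 44/5); free value far under the bar, window-limited only). Assembly = interval union at U' = 5. -/

noncomputable section

namespace Summit.Ventures.CertifiedManyBodySolver.Cruxes.PatchLeftEdge.Birth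

open Set Filter Topology
open Summit.Ventures.CertifiedManyBodySolver.Observables
open Summit.Ventures.CertifiedManyBodySolver.Downfold
open Literature.MathematicalPhysics.QuantumLattice Literature.MathematicalPhysics.QuantumLattice.ThermodynamicLimit
open Literature.Probability.LatticeModels
open Matrix HubbardWave0
open scoped BigOperators ComplexOrder

/-- stub (≥ M): the left-edge bundle on the LOW-U segment U' ∈ [7/2, 5] (own-slot / target-slot reads at the vertex parents
(−27/50, 7/2, 183/200) and (−27/50, 5, 183/200) + the U-segment device + WN density rows; the binding corner is here). -/
def LeftEdgeLowU : Prop :=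
    ∀ n ∈ Icc (87 / 100 : ℝ) (183 / 200), ∀ σ ∈ Icc (-27 / 50 : ℝ) (-13 / 25), ∀ U' ∈ Icc (7 / 2 : ℝ) (5),
    ∀ (ω : InfVolFermionState 2) (Ls : ℕ → ℕ) (ψ : ∀ L, Fock (Orb (FermionTorus 2 L))),
    Tendsto Ls atTop atTop →
    (∀ j, IsGroundStateInSector (hubbardTorusTT' (Ls j) 1 (-27 / 50) U') (rectN n (Ls j)) 0 (ψ (Ls j))) →
    (∀ j, star (ψ (Ls j)) ⬝ᵥ ψ (Ls j) = 1) → ω.IsTorusLimitOf ψ Ls →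
    -(5166800 / 10000000 : ℝ) ≤ ((Finset.univ : Finset (DihedralGroup 4)).card : ℝ)⁻¹ * ∑ g ∈ (Finset.univ : Finset (DihedralGroup 4)),
      (ω.expect (d4ShiftSet g 0 (box 2 7)) (fermionEmbed (PolySite.d4Emb g 0 (box 2 7)) (-oddMomentObsTT σ U' 0))).re

/-- registered stub: `LeftEdgeLowU`. -/
theorem stub_leftEdge_lowU : LeftEdgeLowU := by
  sorry

/-- stub (≥ M): the left-edge bundle on the HIGH-U segment U' ∈ [5, 44/5] (vertex parents (−27/50, 5, ·), (−27/50, 44/5, ·)). -/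
def LeftEdgeHighU : Prop :=
    ∀ n ∈ Icc (87 / 100 : ℝ) (183 / 200), ∀ σ ∈ Icc (-27 / 50 : ℝ) (-13 / 25), ∀ U' ∈ Icc (5 : ℝ) (44 / 5),
    ∀ (ω : InfVolFermionState 2) (Ls : ℕ → ℕ) (ψ : ∀ L, Fock (Orb (FermionTorus 2 L))),
    Tendsto Ls atTop atTop →
    (∀ j, IsGroundStateInSector (hubbardTorusTT' (Ls j) 1 (-27 / 50) U') (rectN n (Ls j)) 0 (ψ (Ls j))) →
    (∀ j, star (ψ (Ls j)) ⬝ᵥ ψ (Ls j) = 1) → ω.IsTorusLimitOf ψ Ls →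
    -(5166800 / 10000000 : ℝ) ≤ ((Finset.univ : Finset (DihedralGroup 4)).card : ℝ)⁻¹ * ∑ g ∈ (Finset.univ : Finset (DihedralGroup 4)),
      (ω.expect (d4ShiftSet g 0 (box 2 7)) (fermionEmbed (PolySite.d4Emb g 0 (box 2 7)) (-oddMomentObsTT σ U' 0))).re

/-- registered stub: `LeftEdgeHighU`. -/
theorem stub_leftEdge_highU : LeftEdgeHighU := by
  sorry

/-- BC3 assembly: the two U-segments give the crux (interval union at U' = 5). -/
theorem PatchLeftEdge_of : Summit.Ventures.CertifiedManyBodySolver.Theses.CovHg1201M19b.PatchLeftEdge := by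
  intro n hn σ hσ U' hU'
  rcases le_total U' 5 with h | h
  · exact stub_leftEdge_lowU n hn σ hσ U' ⟨hU'.1, h⟩
  · exact stub_leftEdge_highU n hn σ hσ U' ⟨h, hU'.2⟩

end Summit.Ventures.CertifiedManyBodySolver.Cruxes.PatchLeftEdge.Birth

end
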